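import Summits.QuantumFields.YangMills.Theorems.IR.ColdDefectFiniteAbelian
import HarnessLib

/-!
# THE NUMBER's currency at an INFINITE compact gauge group: the flat set is Haar-null, `Z_β → 0` at every box (helper for stmt-QuantumFields-26930)

Completes the calibration dichotomy of `ColdDefectFreezingLimit` (p783777) ∕ `ColdDefectFiniteAbelian` (p784277): there, for a FINITE gauge group
the freezing limit of THE NUMBER's currency `coldDefect` is a flat-connection count (`1 − |G|⁻³` for finite abelian `G`); here, for an INFINITE
compact (second countable) gauge group — in particular every compact connected Lie group of positive dimension, the route's groups — the flat set
of every `Fin`-torus with at least two sites in direction `1` has product-Haar measure ZERO, so the partition function freezes to `0`: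

* `haarProbability_singleton_eq_zero` — on an infinite compact group the normalised Haar measure has no atoms;
* `pi_haarProbability_plaquette_eq_zero` — the set of gauge fields with ONE prescribed plaquette holonomy trivial is product-Haar-null
  (Fubini over the first link of the plaquette: the section is a single group element);
* `measureReal_charFlat_eq_zero_of_infinite` — hence `Haar(Flat) = 0` for the character-flat set of a lattice representation;
* `tendsto_wilsonFinTorusPartition_atTop_nhds_zero` — **`Z_β(n₀,n₁,n₂,n₃) → 0` as `β → ∞`** (from `tendsto_wilsonFinTorusPartition_atTop`).

READING.  For the route's groups the `β → ∞` endpoint of THE NUMBER at a fixed box is the `0/0` energy–entropy competition: the freezing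
calibration decides purity for finite groups (never pure) and says nothing for Lie groups — honest scope of the BC5-side chain.
HONEST FRAMING: calibration only; nothing here proves `PinnedExitsCofinalAt`, `IRcof`, `IR`, or the Yang–Mills mass gap.  Def-free.
-/

set_option autoImplicit false

noncomputable section

open Filter Topology MeasureTheory
open Literature.MathematicalPhysics.QuantumFieldTheory Literature.MathematicalPhysics.QuantumLattice

namespace Summit.QuantumFields.YangMills.Cruxes.IR.FreezingLimit

variable {G : Type} [Group G] [TopologicalSpace G] [IsTopologicalGroup G] [CompactSpace G]
  [MeasurableSpace G] [BorelSpace G]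

/-! ## §1 No atoms -/

/-- On an INFINITE compact group the normalised Haar measure gives mass `0` to every point (all point masses are equal by left
invariance; `k` of them would exceed total mass `1`). -/
theorem haarProbability_singleton_eq_zero [MeasurableSingletonClass G] [Infinite G] (g : G) : haarProbability G {g} = 0 := by
  haveI : (haarProbability G).IsMulLeftInvariant := by unfold haarProbability; infer_instance
  have heq : ∀ h : G, haarProbability G {h} = haarProbability G {1} := by
    intro h
    have := measure_preimage_mul (haarProbability G) h⁻¹ ({1} : Set G)
    rw [← this]
    congr 1
    ext x
    simp [eq_comm]
  by_contra hne
  rw [heq] at hne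
  obtain ⟨k, hk⟩ := ENNReal.exists_nat_mul_gt hne ENNReal.one_ne_top
  obtain ⟨s, hs⟩ := Infinite.exists_subset_card_eq G k
  have hsum : haarProbability G (s : Set G) = k * haarProbability G {1} := by
    rw [← sum_measure_singleton (μ := haarProbability G) (s := s)]
    simp only [heq, Finset.sum_const, hs, nsmul_eq_mul]
  have hle : haarProbability G (s : Set G) ≤ 1 := prob_le_one
  rw [hsum] at hle
  exact absurd (lt_of_lt_of_le hk hle) (lt_irrefl _)

/-! ## §2 One prescribed trivial plaquette is a null event -/

variable [SecondCountableTopology G]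

/-- **A single trivial plaquette is Haar-null.**  If every point of `G` is Haar-null, then for any site `x₀` whose `1`-shift differs from
itself, the gauge fields on the `Fin`-torus whose plaquette `(x₀; 0, 1)` has trivial holonomy form a product-Haar-null set: splitting off
the link `(x₀, 0)`, each section is the single group element solving the plaquette equation. -/
theorem pi_haarProbability_plaquette_eq_zero [MeasurableSingletonClass G] (h0 : ∀ g : G, haarProbability G {g} = 0)
    {n₀ n₁ n₂ n₃ : ℕ} (x₀ : FinTorusSite n₀ n₁ n₂ n₃) (hx : x₀.shift 1 ≠ x₀) :
    (Measure.pi fun _ : FinTorusSite n₀ n₁ n₂ n₃ × Fin 4 => haarProbability G)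
      {U : FinTorusSite n₀ n₁ n₂ n₃ × Fin 4 → G | finTorusPlaquette U x₀ 0 1 = 1} = 0 := by
  classical
  have hl₁ : (x₀.shift 0, (1 : Fin 4)) ≠ (x₀, 0) := by simp
  have hl₂ : (x₀.shift 1, (0 : Fin 4)) ≠ (x₀, 0) := by simpa using hx
  have hl₃ : (x₀, (1 : Fin 4)) ≠ (x₀, 0) := by simp
  set A := {U : FinTorusSite n₀ n₁ n₂ n₃ × Fin 4 → G | finTorusPlaquette U x₀ 0 1 = 1} with hA
  -- measurability of A
  have hU : ∀ l : FinTorusSite n₀ n₁ n₂ n₃ × Fin 4,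
      Continuous fun U : FinTorusSite n₀ n₁ n₂ n₃ × Fin 4 → G => U l := fun l => continuous_apply l
  have hcont : Continuous fun U : FinTorusSite n₀ n₁ n₂ n₃ × Fin 4 → G => finTorusPlaquette U x₀ 0 1 :=
    (((hU _).mul (hU _)).mul (hU _).inv).mul (hU _).inv
  have hAm : MeasurableSet A := (measurableSet_singleton (1 : G)).preimage hcont.measurable
  -- split off the link (x₀, 0)
  set e := MeasurableEquiv.piEquivPiSubtypeProd (fun _ : FinTorusSite n₀ n₁ n₂ n₃ × Fin 4 => G)
    (fun l => l = (x₀, 0)) with he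
  have hmp := measurePreserving_piEquivPiSubtypeProd (fun _ : FinTorusSite n₀ n₁ n₂ n₃ × Fin 4 => haarProbability G)
    (fun l => l = (x₀, 0))
  rw [← hmp.symm.measure_preimage_equiv A, Measure.prod_apply_symm (hAm.preimage e.symm.measurable)]
  -- every section is contained in a one-point box, hence null
  refine le_antisymm ((lintegral_mono (g := fun _ => (0 : ENNReal)) fun y => ?_).trans (le_of_eq lintegral_zero)) bot_le
  set c : G := y ⟨(x₀, 1), hl₃⟩ * y ⟨(x₀.shift 1, 0), hl₂⟩ * (y ⟨(x₀.shift 0, 1), hl₁⟩)⁻¹ with hc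
  refine (measure_mono_null (t := Set.pi Set.univ fun _ => {c}) ?_ ?_).le
  · intro x hxA i _
    simp only [Set.mem_preimage, hA, Set.mem_setOf_eq, finTorusPlaquette, he,
      MeasurableEquiv.piEquivPiSubtypeProd_symm_apply] at hxA
    simp only [dif_neg hl₁, dif_neg hl₂, dif_neg hl₃, dif_pos trivial] at hxA
    rw [mul_inv_eq_one, mul_inv_eq_iff_eq_mul] at hxA
    have hi : i = ⟨(x₀, 0), rfl⟩ := Subtype.ext i.2
    subst hi
    rw [Set.mem_singleton_iff, hc, ← hxA, mul_inv_cancel_right]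
  · -- (`convert` absorbs the two `Fintype` instances on the one-point index type)
    convert (show (Measure.pi fun _ : {l : FinTorusSite n₀ n₁ n₂ n₃ × Fin 4 // l = (x₀, 0)} => haarProbability G)
        (Set.pi Set.univ fun _ => ({c} : Set G)) = 0 from by
      rw [Measure.pi_pi]
      exact Finset.prod_eq_zero (i := ⟨(x₀, 0), rfl⟩) (Finset.mem_univ _) (h0 c)) using 3

/-! ## §3 The flat set of an infinite compact group is null; `Z_β → 0` -/

/-- **`Haar(Flat) = 0` for an infinite compact gauge group**: for a lattice representation `r` of an infinite compact (second countable)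
group and every `Fin`-torus with `n₁ ≥ 2` (and all sides `≥ 1`), the character-flat set of THE NUMBER's currency has product-Haar measure zero. -/
theorem measureReal_charFlat_eq_zero_of_infinite [Infinite G] (r : LatticeRep G) {n₀ n₁ n₂ n₃ : ℕ}
    (h₀ : 0 < n₀) (h₁ : 2 ≤ n₁) (h₂ : 0 < n₂) (h₃ : 0 < n₃) :
    (Measure.pi fun _ : FinTorusSite n₀ n₁ n₂ n₃ × Fin 4 => haarProbability G).real
        {U : FinTorusSite n₀ n₁ n₂ n₃ × Fin 4 → G |
          ∀ (x : FinTorusSite n₀ n₁ n₂ n₃) (q : {q : Fin 4 × Fin 4 // q.1 < q.2}),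
            (r.ρ (finTorusPlaquette U x q.1.1 q.1.2)).trace.re = r.N} = 0 := by
  obtain ⟨m, rfl⟩ : ∃ m, n₁ = m + 2 := ⟨n₁ - 2, by omega⟩
  haveI : T2Space G := (r.continuous.isClosedEmbedding r.injective).isEmbedding.t2Space
  haveI : NeZero n₀ := ⟨h₀.ne'⟩
  haveI : NeZero n₂ := ⟨h₂.ne'⟩
  haveI : NeZero n₃ := ⟨h₃.ne'⟩
  set x₀ : FinTorusSite n₀ (m + 2) n₂ n₃ := (0, 0, 0, 0) with hx₀
  have hx : x₀.shift 1 ≠ x₀ := by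
    intro h
    have h2 := congrArg (fun x : FinTorusSite n₀ (m + 2) n₂ n₃ => x.2.1) h
    simp [FinTorusSite.shift, hx₀] at h2
  rw [measureReal_def, measure_mono_null ?_ (pi_haarProbability_plaquette_eq_zero haarProbability_singleton_eq_zero x₀ hx),
    ENNReal.toReal_zero]
  intro U hU
  have h01 := hU x₀ ⟨((0 : Fin 4), (1 : Fin 4)), by decide⟩
  exact (re_trace_eq_iff_eq_one_latticeRep r _).1 h01

/-- **`Z_β → 0` as `β → ∞` for an infinite compact gauge group** (every lattice representation `r`, every `Fin`-torus with `n₁ ≥ 2`):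
the Wilson weight concentrates on the Haar-null flat set. -/
theorem tendsto_wilsonFinTorusPartition_atTop_nhds_zero [Infinite G] (r : LatticeRep G) {n₀ n₁ n₂ n₃ : ℕ}
    (h₀ : 0 < n₀) (h₁ : 2 ≤ n₁) (h₂ : 0 < n₂) (h₃ : 0 < n₃) :
    Tendsto (fun β : ℝ => wilsonFinTorusPartition r.ρ β n₀ n₁ n₂ n₃) atTop (𝓝 0) := by
  have h := tendsto_wilsonFinTorusPartition_atTop r.ρ r.continuous n₀ n₁ n₂ n₃
  rwa [measureReal_charFlat_eq_zero_of_infinite r h₀ h₁ h₂ h₃] at h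

/-- **Both partition functions of THE NUMBER's cold boxes freeze to `0`** for an infinite compact gauge group (`L ≥ 4`): the fixed-box
`β → ∞` endpoint of `coldDefect r.ρ β L = 1 − Z_β(L³×2⌊L/4⌋)/Z_β(L³×⌊L/4⌋)²` is a `0/0` competition. -/
theorem tendsto_coldBox_partitions_nhds_zero [Infinite G] (r : LatticeRep G) {L : ℕ} (hL : 4 ≤ L) :
    Tendsto (fun β : ℝ => wilsonFinTorusPartition r.ρ β L L L (2 * (L / 4))) atTop (𝓝 0) ∧
      Tendsto (fun β : ℝ => wilsonFinTorusPartition r.ρ β L L L (L / 4)) atTop (𝓝 0) := by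
  have hL0 : 0 < L := by omega
  have hL2 : 2 ≤ L := by omega
  have hT : 0 < L / 4 := Nat.div_pos hL (by norm_num)
  exact ⟨tendsto_wilsonFinTorusPartition_atTop_nhds_zero r hL0 hL2 hL0 (by omega),
    tendsto_wilsonFinTorusPartition_atTop_nhds_zero r hL0 hL2 hL0 hT⟩

end Summit.QuantumFields.YangMills.Cruxes.IR.FreezingLimit

end
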